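import Summits.ResolutionOfSingularities.ResolutionOfSingularities.Theses.SeparableGalois
import Literature.AlgebraicGeometry.Resolution.AlterationsResolution
import Literature.AlgebraicGeometry.Resolution.AbsoluteIntegralClosureNoResolution
import Literature.AlgebraicGeometry.Resolution.RegularLocalRingsFlatDescent

/-!
# Disproof of `GaloisQuotientModels` — findings (cdisprove, crux stmt-ResolutionOfSingularities-18955)

Standing disprover's work file for crux W = `SeparableGalois.GaloisQuotientModels` (route
SeparableGalois, rank 2): over every PERFECT field `k` of characteristic `p`, every integral separated
finite-type `X / k` has a proper birational `π : X₁ → X` with `X₁` integral and a finite surjective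
generically étale `q : X' → X₁` from a REGULAR integral `X'`, invariant under an action
`ρ : G →* Aut X'` of a finite group whose orbits are the fibres of `q`.
The ∃-block is abbreviated `Conclusion X` below (`galoisQuotientModels_iff`, by `Iff.rfl`).

## Verdict of cycle 1: NO KILL — and why W resists

* **W is a consequence of the summit** (`conclusion_of_hasResolution`,
  `not_resolutionOfSingularities_of_not_galoisQuotientModels`): a resolution `X₁ → X` is its own
  Galois-quotient model with `X' = X₁`, `q = 𝟙`, `G = 1`. So `¬ W` is a counterexample to resolution of
  singularities in characteristic `p` (a ≥ 4-dimensional variety over a perfect field WITHOUT a weak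
  resolution — `Conclusion` holds in dim ≤ 3 modulo `CossartPiltant2019`, `conclusion_of_dim_le_three`,
  and for regular `X`, `conclusion_of_isRegular`). No such variety is known or conjectured; every cheap
  attack (small models, degenerate cases, junk inhabitants) therefore fails BY THEOREM, not by lack of
  imagination. Negatives index at filing: 1 entry (DefectlessFrames, unrelated).
* **No junk inhabitant** (checked by the route-review and rattack seats, re-checked here): `X'` must be
  finite surjective over `X₁` and regular; `G = 1` forces `q` injective; over `k = k̄` "fibres = orbits" +
  generic étaleness forces `K(X')^G = K(X₁)`. `X₁` need NOT be normal (cusp model of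
  `Theorems/WildQuotientResolution/Negative/CuspModel.lean`: `X₁ = Spec k[t²,t³]`, `X' = 𝔸¹`, `G = 1`).

## Load-bearing analysis (section A; landed sorry-free as
`Theorems/GaloisQuotientModels/Negative/LoadBearing.lean`, proposal p143671)

* `IsIntegral X` — LOAD-BEARING: with the summit's `IsReduced X` instead, FALSE at every prime
  (`galoisQuotientModels_false_without_isIntegral`; witness `Spec (𝔽_p × 𝔽_p)`: an integral `X₁`
  dominating `X` forces `X` irreducible). The assembly's passage to integral closed subschemes is necessary.
* `LocallyOfFiniteType f` — LOAD-BEARING: FALSE at every prime without it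
  (`galoisQuotientModels_false_without_locallyOfFiniteType`; witness `Spec 𝔽_p[T]⁺`, the absolute
  integral closure of the affine line). NEW OBSTRUCTION (`not_conclusion_spec_of_forall_exists_pow_eq`):
  a root-closed domain with a non-zero prime `Q` admits NO proper dominant `X₁ → Spec R` + finite
  surjective `X' → X₁` with `X'` integral and Noetherian-local above `Q` — the comparison map
  `R → 𝒪_{X',x'}` pushes a non-zero `y ∈ Q` into `⋂ₙ 𝔪ⁿ = 0` (Krull) yet is injective (`X'` integral,
  `X' → Spec R` dominant). Moral for provers: finite type enters through Noetherianity of local rings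
  ABOVE the non-generic points of `X`; a modification cannot dodge it.
* `PerfectField k` — NOT load-bearing for truth: the all-fields variant is still a consequence of the
  summit (`not_resolutionOfSingularities_of_not_allFields`), so its necessity cannot be shown without
  refuting the summit. It is there for the MECHANISM (de Jong's generic smoothness / Bertini over
  perfect fields; over imperfect `k` regular ≠ smooth, barrier `RegularNotGeometricallyRegular`).
* `p.Prime` / `CharP` — not load-bearing beyond excluding characteristic `0`, where `Conclusion` holds
  by `Hironaka1964` (named fact); no field has composite characteristic.
* `IsSeparated f`, `QuasiCompact f` — POSSIBLY UNNECESSARY (no witness conceivable: resolution is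
  expected for non-separated / non-quasi-compact integral `X` locally of finite type as well); they are
  inherited from the summit block and cost nothing.

## Boundary / tightness (section B)

* `hasResolution_of_etale_presentation`: if `q` is étale EVERYWHERE then `X₁` is already regular
  (flat local descent of regularity, Matsumura 23.7 (i)) and `π` resolves `X`. ALL the content of W
  beyond the summit sits in the RAMIFICATION of `q` (wild, along the fixed divisors) — exactly where the
  route's crux K (`WildQuotientResolution`) takes over. Equivalently: W ∧ "q étale" ⟺ summit over
  perfect fields.
* `G = 1` is likewise the summit (then `q` is injective, generically étale of degree 1 over `k̄`-points,
  so `X' → X` is itself a resolution) — informal, see docstring of `conclusion_of_isResolution`.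

## Refuted / unrefutable natural strengthenings (section C)

* "no modification" (`π` an isomorphism: `X` itself a Galois quotient of a regular scheme) is FALSE
  already for curves: the nodal cubic `y² + xy = x³` over `𝔽_p` (near-miss `noModification_false_nodal`,
  paper proof in its docstring: a regular `X'` finite over `X` factors through the normalisation, on
  which `G` acts trivially, so the two branches over the node are in different orbits of one fibre).
  For NORMAL `X` it is false from dimension 2: the cone over a smooth plane cubic has infinite local
  étale fundamental group (pull back isogenies), whereas `𝒪^{sh}_{X'/G}` has local `π₁` a quotient of
  the stabiliser by Zariski–Nagata purity for the regular `𝒪^{sh}_{X'}` (SGA 2 X.3.4; Artin 1977).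
  Not formalisable this cycle (normalisation / local π₁ API); recorded, not landed.
* "q étale", "G trivial", "X₁ normal / projective", "k arbitrary": each is implied by (strong) resolution,
  hence unrefutable here.

## Targets (section D)

`stuck_stubs` empty at arming. The lead's PICKED line is the ideation `Sketch`
(`Cruxes/GaloisQuotientModels/SketchIdeator1.lean`: `stub_ferocify`, `stub_sandwich`); both stubs are
TRUE (hand proofs in `PICKED.md`, re-derived here) — nothing to kill. Mutation remarks for the provers
(checked below, `Targets`): in `stub_ferocify` the hypotheses `hu : u ∈ 𝔪`, `hy : y ∈ 𝔪` are REDUNDANT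
(they follow from `hpar`, the quotient `A ⧸ (u, y)` being a local, hence nontrivial, ring —
`mem_maximalIdeal_of_isRegularLocalRing_quotient`), and `hm : 0 < m` is UNNECESSARY (`m = 0` is an
Artin–Schreier, i.e. étale, layer, regular over the regular `A₁`).

## Side remark on the route's mechanism (EFL), not on W

The `(ℤ/p)^s`-translation specimens `Y = 𝔸^{s+1}`, `y_i ↦ y_i + a_i x`, of the route's "cheapest
falsifier (b)" satisfy W trivially (`X' = Y`, `π = 𝟙`, `q` the quotient map, étale off `x = 0`), so they
can never be counterexamples to W; and for EFL itself the invariant fibration `t = (x, N_1, …, N_{s-1})`,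
`N_i = y_i^p − x^{p−1} y_i`, has Stein factor `k(x, y_1, …, y_{s−1})` and generic fibre `𝔸¹` (in `y_s`)
for EVERY `s` (the fierce divisor `x = 0` is vertical; the residual `ℤ/p` acts on the `𝔸¹`-fibres by
translation, fixing only the section at infinity, a wild but not fierce marking) — agreeing with the
rattack seat's CRUX-ATTACK §7, as far as the route text specifies EFL (the birth skeleton's exact typing
of EFL was not readable from this seat); the planner's "s = 3 open" is not an obstruction in this family.

## For the provers: assembling `Conclusion X` from a genuine quotient (nearest facts)

Once a regular integral `X'` with `ρ : G →* Aut X'` and a proper birational `X'/G → X` are in hand,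
the clauses of `Conclusion` are served by: `Literature.AlgebraicGeometry.RelativeSpec.FiniteGroupQuotient`
(`ActionOver.toQuotient`, invariance `aut_hom_toQuotient`), `…FiniteGroupQuotientGluing` (the glued
quotient exists when every point has a `G`-stable affine neighbourhood — automatic for quasi-projective
`X'`), `…FiniteGroupQuotientGenericEtale.exists_etale_morphismRestrict_gluedMk` (étale over a non-empty,
hence dense, open for an action faithful on `K(X')`; quotient out the kernel first), finiteness and
surjectivity of `X' → X'/G` (integrality of `B` over `B^G`, Mathlib `Algebra.IsInvariant`), and the ORBIT
clause affine-locally by Mathlib `Algebra.IsInvariant.exists_smul_of_under_eq` (any two primes of `B`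
over one prime of `B^G` are `G`-conjugate). Integrality of `X'/G`: image of the integral `X'`.
None of this touches the difficulty, which is producing `X'` REGULAR with `K(X')^G = K(X)` (separable!).

## Index of declarations
A. `Conclusion`, `galoisQuotientModels_iff`, `conclusion_of_isResolution`, `conclusion_of_hasResolution`,
   `conclusion_of_isRegular`, `conclusion_of_dim_le_three`, `not_resolutionOfSingularities_of_not_allFields`,
   `not_resolutionOfSingularities_of_not_galoisQuotientModels`, `GaloisQuotientModelsWithoutIsIntegral`,
   `galoisQuotientModels_false_without_isIntegral`, `GaloisQuotientModelsWithoutLocallyOfFiniteType`,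
   `not_conclusion_spec_of_forall_exists_pow_eq`, `galoisQuotientModels_false_without_locallyOfFiniteType`,
   `GaloisQuotientModelsAllFields`, `conclusionWithoutRegular_trivial` (IsRegular X' carries all content).
B. `isRegular_of_etale_surjective`, `hasResolution_of_etale_presentation`.
C. `noModification_false_nodal` (sorry — near-miss, paper proof in docstring).
D. `mem_maximalIdeal_of_isRegularLocalRing_quotient` (stub_ferocify mutation).
-/

noncomputable section

-- single-problem summit: the doubled namespace component `ResolutionOfSingularities` is forced
set_option linter.dupNamespace false

open CategoryTheory AlgebraicGeometry TopologicalSpace Topology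
open Literature.AlgebraicGeometry.Resolution

namespace Summit.ResolutionOfSingularities.ResolutionOfSingularities.Cruxes.GaloisQuotientModels.Disproof

open Summit.ResolutionOfSingularities.ResolutionOfSingularities.Theses.SeparableGalois (GaloisQuotientModels)

/-! ## A. The statement, its logical position, load-bearing hypotheses -/

/-- The ∃-block of the crux for one scheme `X`: a proper birational `X₁ → X` with `X₁` integral and a
Galois-type presentation `q : X' → X₁` of `X₁` by a regular integral `X'`. -/
def Conclusion (X : Scheme.{0}) : Prop :=
  ∃ (X₁ X' : Scheme.{0}) (π : X₁ ⟶ X) (q : X' ⟶ X₁) (G : Type) (_ : Group G) (_ : Finite G)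
    (ρ : G →* Aut X'), IsProper π ∧ IsBirational π ∧ IsIntegral X₁ ∧ IsIntegral X' ∧
    Scheme.IsRegular X' ∧ IsFinite q ∧ Function.Surjective q.base ∧
    (∃ U : X₁.Opens, Dense (U : Set X₁) ∧ Etale (q ∣_ U)) ∧ (∀ g : G, (ρ g).hom ≫ q = q) ∧
    (∀ x y : X', q.base x = q.base y → ∃ g : G, (ρ g).hom.base x = y)

/-- Read-back of the crux: W is `∀ p prime, ∀ perfect k of char p, ∀ integral separated finite-type
X / k, Conclusion X` — definitionally. -/
theorem galoisQuotientModels_iff :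
    GaloisQuotientModels ↔ ∀ p : ℕ, p.Prime → ∀ (k : Type) [Field k] [CharP k p] [PerfectField k]
      (X : Scheme.{0}) (f : X ⟶ Spec (.of k)), IsSeparated f → LocallyOfFiniteType f →
      QuasiCompact f → IsIntegral X → Conclusion X :=
  Iff.rfl

/-- The crux WITHOUT `PerfectField k` (all fields of characteristic `p`). -/
def GaloisQuotientModelsAllFields : Prop :=
  ∀ p : ℕ, p.Prime → ∀ (k : Type) [Field k] [CharP k p] (X : Scheme.{0}) (f : X ⟶ Spec (.of k)),
    IsSeparated f → LocallyOfFiniteType f → QuasiCompact f → IsIntegral X → Conclusion X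

/-- The crux with the summit's hypothesis `IsReduced X` in place of `IsIntegral X`. -/
def GaloisQuotientModelsWithoutIsIntegral : Prop :=
  ∀ p : ℕ, p.Prime → ∀ (k : Type) [Field k] [CharP k p] [PerfectField k] (X : Scheme.{0})
    (f : X ⟶ Spec (.of k)), IsSeparated f → LocallyOfFiniteType f → QuasiCompact f → IsReduced X →
    Conclusion X

/-- The crux with `LocallyOfFiniteType f` dropped. -/
def GaloisQuotientModelsWithoutLocallyOfFiniteType : Prop :=
  ∀ p : ℕ, p.Prime → ∀ (k : Type) [Field k] [CharP k p] [PerfectField k] (X : Scheme.{0})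
    (f : X ⟶ Spec (.of k)), IsSeparated f → QuasiCompact f → IsIntegral X → Conclusion X

/-- Trivial presentation from a resolution: `X' = X₁`, `q = 𝟙`, `G = 1`. [folklore] -/
theorem conclusion_of_isResolution {X X₁ : Scheme.{0}} [IsIntegral X] {π : X₁ ⟶ X}
    (h : IsResolution π) : Conclusion X := by
  haveI : IsReduced X₁ := h.isRegular.isReduced
  haveI : IsIntegral X₁ := h.isBirational.isIntegral
  haveI : IsProper π := h.isProper
  refine ⟨X₁, X₁, π, 𝟙 X₁, PUnit.{1}, inferInstance, inferInstance, 1, inferInstance, h.isBirational,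
    inferInstance, inferInstance, h.isRegular, inferInstance, ?_, ⟨⊤, by simp, inferInstance⟩,
    fun g => Category.id_comp _, fun x y hxy => ⟨1, hxy⟩⟩
  intro x; exact ⟨x, by simp⟩

/-- `Conclusion X` from any resolution of an integral `X`. [folklore] -/
theorem conclusion_of_hasResolution {X : Scheme.{0}} [IsIntegral X] (h : Scheme.HasResolution X) :
    Conclusion X := by
  obtain ⟨X₁, π, hπ⟩ := h
  exact conclusion_of_isResolution hπ

/-- Known slice: regular `X` (`X₁ = X' = X`). [folklore] -/
theorem conclusion_of_isRegular {X : Scheme.{0}} [IsIntegral X] (h : Scheme.IsRegular X) :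
    Conclusion X :=
  conclusion_of_hasResolution h.hasResolution

/-- Known slice: dimension `≤ 3`, modulo the named fact `CossartPiltant2019` (any field). [folklore] -/
theorem conclusion_of_dim_le_three (hCP : CossartPiltant2019.{0}) {k : Type} [Field k]
    (X : Scheme.{0}) (f : X ⟶ Spec (.of k)) [IsSeparated f] [LocallyOfFiniteType f] [QuasiCompact f]
    [IsIntegral X] (hdim : topologicalKrullDim X ≤ 3) : Conclusion X :=
  conclusion_of_hasResolution (hCP k X f ‹_› ‹_› ‹_› inferInstance hdim)

/-- **Summit ⇒ all-fields variant** (contrapositive form): `PerfectField k` is not load-bearing for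
truth-modulo-the-summit. [folklore] -/
theorem not_resolutionOfSingularities_of_not_allFields (h : ¬ GaloisQuotientModelsAllFields) :
    ¬ _root_.ResolutionOfSingularities := fun hR =>
  h fun p hp k _ _ X f hs hl hq _ =>
    conclusion_of_hasResolution ((_root_.ResolutionOfSingularities_iff.mp hR p hp) k X f hs hl hq
      inferInstance)

/-- All-fields variant ⇒ W (contrapositive form). [folklore] -/
theorem not_allFields_of_not_galoisQuotientModels (h : ¬ GaloisQuotientModels) :
    ¬ GaloisQuotientModelsAllFields := fun hall =>
  h fun p hp k _ _ _ X f hs hl hq hi => hall p hp k X f hs hl hq hi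

/-- **¬W ⇒ ¬Summit**: a disproof of the crux is a counterexample to resolution in characteristic `p`.
[folklore] -/
theorem not_resolutionOfSingularities_of_not_galoisQuotientModels (h : ¬ GaloisQuotientModels) :
    ¬ _root_.ResolutionOfSingularities :=
  not_resolutionOfSingularities_of_not_allFields (not_allFields_of_not_galoisQuotientModels h)

/-- The conclusion forces `X` irreducible (`X₁` integral, `π` dominant). [folklore] -/
theorem irreducibleSpace_of_conclusion {X : Scheme.{0}} (h : Conclusion X) : IrreducibleSpace X := by
  obtain ⟨X₁, X', π, q, G, _, _, ρ, hπ, hbir, h1, -⟩ := h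
  haveI := hbir.isDominant
  have hpre : IsPreirreducible (Set.range π.base) := by
    rw [← Set.image_univ]
    exact (IrreducibleSpace.isIrreducible_univ X₁).2.image _ π.base.hom.continuous.continuousOn
  have huniv : IsPreirreducible (Set.univ : Set X) := by
    rw [← π.denseRange.closure_range]; exact hpre.closure
  obtain ⟨x₁⟩ := (inferInstance : Nonempty X₁)
  haveI : PreirreducibleSpace X := ⟨huniv⟩
  exact ⟨⟨π.base x₁⟩⟩

/-- `Spec (K × K)` is not irreducible. [folklore] -/
theorem not_irreducibleSpace_spec_prod (K : Type) [Field K] :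
    ¬ IrreducibleSpace (Spec (.of (K × K))) := by
  intro h
  haveI : PreirreducibleSpace (PrimeSpectrum (K × K)) := h.toPreirreducibleSpace
  let P₁ : PrimeSpectrum (K × K) := ⟨RingHom.ker (RingHom.fst K K), RingHom.ker_isPrime _⟩
  let P₂ : PrimeSpectrum (K × K) := ⟨RingHom.ker (RingHom.snd K K), RingHom.ker_isPrime _⟩
  have h1 : P₁ ∈ PrimeSpectrum.basicOpen ((1, 0) : K × K) := by
    rw [PrimeSpectrum.mem_basicOpen]; simp [P₁, RingHom.mem_ker]
  have h2 : P₂ ∈ PrimeSpectrum.basicOpen ((0, 1) : K × K) := by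
    rw [PrimeSpectrum.mem_basicOpen]; simp [P₂, RingHom.mem_ker]
  have hd : Dense ((PrimeSpectrum.basicOpen ((1, 0) : K × K) : Opens (PrimeSpectrum (K × K))) :
      Set (PrimeSpectrum (K × K))) :=
    (PrimeSpectrum.basicOpen ((1, 0) : K × K)).isOpen.dense ⟨P₁, h1⟩
  obtain ⟨z, hz2, hz1⟩ := hd.inter_open_nonempty _ (PrimeSpectrum.basicOpen ((0, 1) : K × K)).isOpen
    ⟨P₂, h2⟩
  have hz : z ∈ PrimeSpectrum.basicOpen ((1, 0) * (0, 1) : K × K) := by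
    rw [PrimeSpectrum.basicOpen_mul]; exact ⟨hz1, hz2⟩
  have h0 : ((1, 0) * (0, 1) : K × K) = 0 := by simp
  rw [h0, PrimeSpectrum.basicOpen_zero] at hz
  exact TopologicalSpace.Opens.mem_bot.mp hz

/-- A product of reduced rings is reduced. [folklore] -/
theorem isReduced_prod (R S : Type*) [CommRing R] [CommRing S] [IsReduced R] [IsReduced S] :
    IsReduced (R × S) := by
  refine ⟨fun x hx => ?_⟩
  obtain ⟨n, hn⟩ := hx
  have h1 : x.1 ^ n = 0 := by simpa using congrArg Prod.fst hn
  have h2 : x.2 ^ n = 0 := by simpa using congrArg Prod.snd hn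
  exact Prod.ext (IsReduced.eq_zero _ ⟨n, h1⟩) (IsReduced.eq_zero _ ⟨n, h2⟩)

/-- **`IsIntegral X` is load-bearing, at every prime**: witness `Spec (𝔽_p × 𝔽_p) → Spec 𝔽_p`.
[folklore] -/
theorem galoisQuotientModels_false_without_isIntegral_at (p : ℕ) [Fact p.Prime] :
    ¬ ∀ (k : Type) [Field k] [CharP k p] [PerfectField k] (X : Scheme.{0}) (f : X ⟶ Spec (.of k)),
      IsSeparated f → LocallyOfFiniteType f → QuasiCompact f → IsReduced X → Conclusion X := by
  intro h
  let f : Spec (.of (ZMod p × ZMod p)) ⟶ Spec (.of (ZMod p)) :=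
    Spec.map (CommRingCat.ofHom (algebraMap (ZMod p) (ZMod p × ZMod p)))
  haveI : LocallyOfFiniteType f := by
    rw [HasRingHomProperty.Spec_iff (P := @LocallyOfFiniteType), CommRingCat.hom_ofHom,
      RingHom.finiteType_algebraMap]
    infer_instance
  haveI := isReduced_prod (ZMod p) (ZMod p)
  exact not_irreducibleSpace_spec_prod (ZMod p) (irreducibleSpace_of_conclusion
    (h (ZMod p) (Spec (.of (ZMod p × ZMod p))) f inferInstance inferInstance inferInstance inferInstance))

/-- **Any proof must use `IsIntegral X`** (`IsReduced` does not suffice). [folklore] -/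
theorem galoisQuotientModels_false_without_isIntegral : ¬ GaloisQuotientModelsWithoutIsIntegral :=
  fun h =>
    haveI : Fact (Nat.Prime 2) := ⟨Nat.prime_two⟩
    galoisQuotientModels_false_without_isIntegral_at 2 (h 2 Nat.prime_two)

/-- **Key obstruction** (root-closed domains have no Galois-quotient model): `R` a domain in which every
element is an `n`-th power (`n ≥ 2`) with a non-zero prime `Q` ⇒ `¬ Conclusion (Spec R)`. The local
ring of `X'` above `Q` is regular, hence Noetherian, and receives `R` with `Q ↦ 𝔪`; a non-zero `y ∈ Q`
has `n^i`-th roots in `Q` for all `i`, so lands in `⋂ 𝔪^i = 0`; but `R → 𝒪_{X',x'}` is injective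
(`X'` integral, `X' → Spec R` dominant). [folklore] -/
theorem not_conclusion_spec_of_forall_exists_pow_eq (R : Type) [CommRing R] [IsDomain R]
    {n : ℕ} (hn : 2 ≤ n) (hpow : ∀ a : R, ∃ b : R, b ^ n = a)
    (hQ : ∃ Q : Ideal R, Q.IsPrime ∧ Q ≠ ⊥) : ¬ Conclusion (Spec (.of R)) := by
  rintro ⟨X₁, X', π, q, G, _, _, ρ, hπ, hbir, h1, h2, hreg, -, hsurj, -, -, -⟩
  obtain ⟨Q, hQp, hQne⟩ := hQ
  obtain ⟨y, hyQ, hy0⟩ := Submodule.exists_mem_ne_zero_of_ne_bot hQne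
  let x₀ : Spec (.of R) := ⟨Q, hQp⟩
  haveI := hbir.isDominant
  haveI : Surjective q := ⟨hsurj⟩
  have hπsurj : Function.Surjective π.base :=
    (surjective_of_isDominant_of_isClosed_range π π.isClosedMap.isClosed_range).1
  obtain ⟨x₁, hx₁⟩ := hπsurj x₀
  obtain ⟨x', hx'⟩ := hsurj x₁
  let g : X' ⟶ Spec (.of R) := q ≫ π
  have hgx : g.base x' = x₀ := by simp [g, hx', hx₁]
  haveI : IsDominant g := inferInstanceAs (IsDominant (q ≫ π))
  haveI : IsRegularLocalRing (X'.presheaf.stalk x') := hreg x'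
  let s : R → Γ(X', ⊤) := fun a => g.appTop ((Scheme.ΓSpecIso (.of R)).inv a)
  let φ : R →+* X'.presheaf.stalk x' :=
    (X'.presheaf.germ ⊤ x' trivial).hom.comp ((g.appTop).hom.comp (Scheme.ΓSpecIso (.of R)).inv.hom)
  have hφ : ∀ a, φ a = X'.presheaf.germ ⊤ x' trivial (s a) := fun a => rfl
  have hmem : ∀ a ∈ Q, φ a ∈ IsLocalRing.maximalIdeal (X'.presheaf.stalk x') := by
    intro a ha
    rw [IsLocalRing.mem_maximalIdeal, mem_nonunits_iff, hφ]
    intro hu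
    have hx : x' ∈ X'.basicOpen (s a) := (X'.mem_basicOpen_top (s a) x').mpr hu
    have : x' ∈ g ⁻¹ᵁ (Spec (.of R)).basicOpen ((Scheme.ΓSpecIso (.of R)).inv a) := by
      rwa [Scheme.preimage_basicOpen_top]
    rw [basicOpen_eq_of_affine] at this
    have hx₀ : x₀ ∈ PrimeSpectrum.basicOpen a := hgx ▸ this
    exact (PrimeSpectrum.mem_basicOpen a x₀).mp hx₀ ha
  have hpow' : ∀ i : ℕ, ∀ a ∈ Q, φ a ∈ IsLocalRing.maximalIdeal (X'.presheaf.stalk x') ^ i := by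
    intro i
    induction i with
    | zero => intro a _; simp
    | succ i ih =>
      intro a ha
      obtain ⟨b, rfl⟩ := hpow a
      have hb : b ∈ Q := hQp.mem_of_pow_mem n ha
      obtain ⟨m, rfl⟩ : ∃ m, n = m + 2 := ⟨n - 2, by omega⟩
      rw [map_pow, pow_succ (φ b) (m + 1), pow_succ (IsLocalRing.maximalIdeal _) i]
      refine Ideal.mul_mem_mul ?_ (hmem b hb)
      rw [pow_succ']
      exact Ideal.mul_mem_right _ _ (ih b hb)
  have hy_mem : φ y ∈ ⨅ i : ℕ, IsLocalRing.maximalIdeal (X'.presheaf.stalk x') ^ i :=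
    Ideal.mem_iInf.mpr fun i => hpow' i y hyQ
  rw [Ideal.iInf_pow_eq_bot_of_isLocalRing _ (IsLocalRing.maximalIdeal.isMaximal _).ne_top,
    Ideal.mem_bot, hφ] at hy_mem
  have hs0 : s y = 0 :=
    germ_injective_of_isIntegral X' (U := ⊤) x' trivial (by rw [hy_mem, map_zero])
  have hpre : g ⁻¹ᵁ (Spec (.of R)).basicOpen ((Scheme.ΓSpecIso (.of R)).inv y) = ⊥ := by
    rw [Scheme.preimage_basicOpen_top]
    change X'.basicOpen (s y) = ⊥
    rw [hs0, Scheme.basicOpen_zero]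
  rw [basicOpen_eq_of_affine] at hpre
  have hne : ((PrimeSpectrum.basicOpen y : Opens (PrimeSpectrum R)) : Set (PrimeSpectrum R)).Nonempty := by
    refine ⟨⟨⊥, Ideal.isPrime_bot⟩, ?_⟩
    change (⟨⊥, Ideal.isPrime_bot⟩ : PrimeSpectrum R) ∈ PrimeSpectrum.basicOpen y
    rw [PrimeSpectrum.mem_basicOpen]
    simpa using hy0
  obtain ⟨z, hz, ⟨w, rfl⟩⟩ :=
    g.denseRange.inter_open_nonempty _ (PrimeSpectrum.basicOpen y).isOpen hne
  have : w ∈ g ⁻¹ᵁ (PrimeSpectrum.basicOpen y) := hz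
  rw [hpre] at this
  exact TopologicalSpace.Opens.mem_bot.mp this

open Polynomial in
/-- **`LocallyOfFiniteType f` is load-bearing, at every prime**: witness `Spec 𝔽_p[T]⁺ → Spec 𝔽_p`
(absolute integral closure of the affine line: every element a square, `T` in a non-zero prime).
[folklore] -/
theorem galoisQuotientModels_false_without_locallyOfFiniteType_at (p : ℕ) [Fact p.Prime] :
    ¬ ∀ (k : Type) [Field k] [CharP k p] [PerfectField k] (X : Scheme.{0}) (f : X ⟶ Spec (.of k)),
      IsSeparated f → QuasiCompact f → IsIntegral X → Conclusion X := by
  intro h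
  have hX0 : algebraMap (ZMod p)[X]
      ↥(integralClosure (ZMod p)[X] (AlgebraicClosure (RatFunc (ZMod p)))) X ≠ 0 :=
    fun h0 => Polynomial.X_ne_zero
      (absoluteIntegralClosure_algebraMap_injective p (by rw [h0, map_zero]))
  obtain ⟨Q, hQ, hQne, -⟩ := absoluteIntegralClosure_exists_prime_not_mem p _ hX0
  exact not_conclusion_spec_of_forall_exists_pow_eq
    ↥(integralClosure (ZMod p)[X] (AlgebraicClosure (RatFunc (ZMod p)))) le_rfl
    (absoluteIntegralClosure_exists_sq_eq p) ⟨Q, hQ, hQne⟩ (h (ZMod p) _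
      (Spec.map (CommRingCat.ofHom ((algebraMap (ZMod p)[X]
        ↥(integralClosure (ZMod p)[X] (AlgebraicClosure (RatFunc (ZMod p))))).comp Polynomial.C)))
      inferInstance inferInstance inferInstance)

/-- **Any proof must use `LocallyOfFiniteType f`** (through Noetherianity above the non-generic points
of `X`). [folklore] -/
theorem galoisQuotientModels_false_without_locallyOfFiniteType :
    ¬ GaloisQuotientModelsWithoutLocallyOfFiniteType := fun h =>
  haveI : Fact (Nat.Prime 2) := ⟨Nat.prime_two⟩
  galoisQuotientModels_false_without_locallyOfFiniteType_at 2 (h 2 Nat.prime_two)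

/-- **With `Scheme.IsRegular X'` deleted the conclusion is TRIVIAL** for every integral `X`
(`X₁ = X' = X`, `π = q = 𝟙`, `G = 1`): all the content of W is the regularity of the cover `X'`
(compare `Theorems/WildQuotientResolution/Negative/CounterexampleShape.wq_without_isRegular_iff_…`).
[folklore] -/
theorem conclusionWithoutRegular_trivial (X : Scheme.{0}) [IsIntegral X] :
    ∃ (X₁ X' : Scheme.{0}) (π : X₁ ⟶ X) (q : X' ⟶ X₁) (G : Type) (_ : Group G) (_ : Finite G)
      (ρ : G →* Aut X'), IsProper π ∧ IsBirational π ∧ IsIntegral X₁ ∧ IsIntegral X' ∧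
      IsFinite q ∧ Function.Surjective q.base ∧
      (∃ U : X₁.Opens, Dense (U : Set X₁) ∧ Etale (q ∣_ U)) ∧ (∀ g : G, (ρ g).hom ≫ q = q) ∧
      (∀ x y : X', q.base x = q.base y → ∃ g : G, (ρ g).hom.base x = y) := by
  refine ⟨X, X, 𝟙 X, 𝟙 X, PUnit.{1}, inferInstance, inferInstance, 1, inferInstance,
    ⟨⊤, by simp, by simp, inferInstance⟩, inferInstance, inferInstance, inferInstance, ?_,
    ⟨⊤, by simp, inferInstance⟩, fun g => Category.id_comp _, fun x y hxy => ⟨1, hxy⟩⟩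
  intro x; exact ⟨x, by simp⟩

/-! ## B. Boundary: the étale strengthening is the summit -/

/-- Regularity descends along an étale surjection onto a locally Noetherian scheme (Matsumura 23.7 (i),
in tree as `IsRegularLocalRing.of_flat_ringHom`). [cite: Matsumura1987, Thm. 23.7 (i)] -/
theorem isRegular_of_etale_surjective {X' X₁ : Scheme.{0}} (q : X' ⟶ X₁) [Etale q]
    (hsurj : Function.Surjective q.base) [IsLocallyNoetherian X₁] (hreg : Scheme.IsRegular X') :
    Scheme.IsRegular X₁ := by
  intro x₁
  obtain ⟨x', rfl⟩ := hsurj x₁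
  haveI := hreg x'
  exact IsRegularLocalRing.of_flat_ringHom (q.stalkMap x').hom (Flat.stalkMap q x')

/-- **W with `q` étale everywhere resolves `X`** (and in the crux `X₁` is locally Noetherian, being
proper over the finite-type `X`, `LocallyOfFiniteType.isLocallyNoetherian (π ≫ f)`): the whole content
of the crux beyond the summit is the ramification of `q`. [folklore] -/
theorem hasResolution_of_etale_presentation {X X₁ X' : Scheme.{0}} (π : X₁ ⟶ X) (q : X' ⟶ X₁)
    [IsProper π] (hbir : IsBirational π) [Etale q] (hsurj : Function.Surjective q.base)
    [IsLocallyNoetherian X₁] (hreg : Scheme.IsRegular X') : Scheme.HasResolution X :=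
  ⟨X₁, π, inferInstance, hbir, isRegular_of_etale_surjective q hsurj hreg⟩

/-! ## C. Natural strengthenings -/

/-- The conclusion WITHOUT the modification `π` (i.e. `X₁ = X`): `X` itself is a Galois-type quotient of
a regular scheme. -/
def ConclusionNoModification (X : Scheme.{0}) : Prop :=
  ∃ (X' : Scheme.{0}) (q : X' ⟶ X) (G : Type) (_ : Group G) (_ : Finite G) (ρ : G →* Aut X'),
    IsIntegral X' ∧ Scheme.IsRegular X' ∧ IsFinite q ∧ Function.Surjective q.base ∧
    (∃ U : X.Opens, Dense (U : Set X) ∧ Etale (q ∣_ U)) ∧ (∀ g : G, (ρ g).hom ≫ q = q) ∧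
    (∀ x y : X', q.base x = q.base y → ∃ g : G, (ρ g).hom.base x = y)

/-- NEAR-MISS (paper proof only; `sorry`): **the modification is load-bearing already for curves** — the
nodal cubic `X = Spec k[x,y]/(y² + xy − x³)` (node at the origin with two distinct tangents `y = 0`,
`y = −x` in every characteristic; a Weierstrass cubic, hence integral) admits NO Galois-type presentation
by a regular scheme. Paper proof: `q : X' → X` finite with `X'` regular (normal) integral factors through
the normalisation `ν : X̃ = 𝔸¹ → X` (integral closure of `𝒪(X)` in `K(X) ⊆ K(X')` lies in the normal
`𝒪(X')`); `G` acts on `X'` by `X`-automorphisms, hence trivially on `K(X)` and on `X̃`, so `X' → X̃` is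
`G`-invariant and `G`-orbits lie in its fibres; but `X' → X̃` is surjective and `ν⁻¹(node)` has two
points, so the `q`-fibre over the node meets two distinct `X' → X̃`-fibres — it is not a single orbit.
(For NORMAL `X` the strengthening fails from dimension 2: cone over a smooth plane cubic, infinite local
étale `π₁` versus Zariski–Nagata purity for `X'`; SGA 2 X.3.4.) Obstruction to formalising: no
normalisation-factorisation / branch-counting API in tree; what was tried: nothing beyond typing.
[cite: Hartshorne1977, I Ex. 3.2 and II Ex. 3.8 (normalisation of the node)] -/
theorem noModification_false_nodal (k : Type) [Field k] :
    ¬ ConclusionNoModification (Spec (.of (MvPolynomial (Fin 2) k ⧸ Ideal.span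
      {(MvPolynomial.X 1 ^ 2 + MvPolynomial.X 0 * MvPolynomial.X 1 - MvPolynomial.X 0 ^ 3 :
        MvPolynomial (Fin 2) k)}))) := by
  sorry

/-! ## D. Targets — the picked line `Sketch` (stubs `stub_ferocify`, `stub_sandwich`, both TRUE) -/

/-- Mutation remark on `FerociousEnlargement.stub_ferocify`: its hypotheses `hu : u ∈ 𝔪_A` and
`hy : y ∈ 𝔪_A` are REDUNDANT — they follow from `hpar : IsRegularLocalRing (A ⧸ (u, y))`, a local ring
being nontrivial. (And `hm : 0 < m` is unnecessary: for `m = 0` the second layer `W^p − W − y` is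
Artin–Schreier, étale over the regular `A₁`.) [folklore] -/
theorem mem_maximalIdeal_of_isRegularLocalRing_quotient {A : Type} [CommRing A] [IsLocalRing A]
    (u y : A) (hpar : IsRegularLocalRing (A ⧸ Ideal.span ({u, y} : Set A))) :
    u ∈ IsLocalRing.maximalIdeal A ∧ y ∈ IsLocalRing.maximalIdeal A := by
  have hne : Ideal.span ({u, y} : Set A) ≠ ⊤ := fun htop =>
    not_subsingleton (A ⧸ Ideal.span ({u, y} : Set A)) (Ideal.Quotient.subsingleton_iff.mpr htop)
  have hle : Ideal.span ({u, y} : Set A) ≤ IsLocalRing.maximalIdeal A :=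
    IsLocalRing.le_maximalIdeal hne
  exact ⟨hle (Ideal.subset_span (by simp)), hle (Ideal.subset_span (by simp))⟩

end Summit.ResolutionOfSingularities.ResolutionOfSingularities.Cruxes.GaloisQuotientModels.Disproof

end
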